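import Summits.BirchSwinnertonDyer.Rank1Residual.X12.O11.RouteUInvMulOmega
import Summits.BirchSwinnertonDyer.Rank1Residual.X12.O11.RouteUPsiD11
import Literature.NumberTheory.EllipticCurves.KrizLi2019.TeichmullerCharacterExists
import Mathlib.RingTheory.IntegralDomain
import HarnessLib

/-!
# Crux `PrintCFram.BottomClassIndexLawFiveLe` (stmt-BirchSwinnertonDyer-20372), line `eisenstein-resource-bdp-line`:
# the KRIZ–LI BINDERS CLASS-LEVEL, part Ψ — the character `ψ = χ · ω^k` of Kriz–Li Thm. 1.20 at ANY odd prime `p`: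
# primitivity, the zeros giving hypotheses (1)/(3), the conductor of `ψ⁻¹ω`, the trace identity, the parity
# (cell `bsd-print-cfram`, width seat `bsd-line-cfram-p1-w3` g2; THEOREMS ONLY, `--supports` 20372; BSD is not proved by any of this)

HONEST FRAMING. Nothing here is a statement about BSD or about any curve. The named fact
`KrizLi2019.thm120_padicLogHeegner_unit_of_bernoulli` (Kriz–Li, FMS 7 (2019) Thm. 1.20) and the line's «Kriz–Li datum» take
`ψ : DirichletCharacter ℚ_[p] f` PRIMITIVE, `ω` Teichmüller, the trace form `hss`, and (1) `ψ(p) ≠ 1 ∧ (ψ⁻¹ω)(p) ≠ 1`,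
(3) `ψ(ℓ) ≠ 1 ∧ (ψ⁻¹ω)(ℓ) ≠ 1` at the additive `ℓ ≠ p`. Cell `bsd-cm`'s Route U built `ψ = χ·ω²` at `p = 7`
(`RouteUJacobiPsi`, `RouteUPrimePsi`, `RouteUKroneckerPsi`: `ℚ_7`, exponent `2`). This file is the generic layer, for ANY
prime `p`, ANY exponent `k` and ANY primitive quadratic `χ` mod `m` coprime to `p`; on the crux's class
`k ∈ {(p+1)/4, (3p−1)/4}` and `χ = χ_D` (parts K-odd / K-even), assembled in part W:

* §1 Teichmüller: `teichmuller_pow_ne_one` (`ω^j ≠ 1` for `0 < j < p − 1`: `(ℤ/p)ˣ` is cyclic and `ω(g) ≡ g`),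
  `teichmuller_apply_neg_one` (`ω(−1) = −1`), `teichmuller_pow_ne_one_and` (the two non-vanishings used below for `2 ≤ k ≤ p−2`).
* §2 `ψ := χ↑ · (ω^k)↑` at level `p·m`: `psi_apply_natCast_of_coprime` / `_of_not_coprime` (values),
  **`psi_isPrimitive`** (conductor `p·m`), `psi_apply_natCast_ne_one` ((1a)/(3a): `ψ(a) = 0 ≠ 1` for `(a, pm) ≠ 1`),
  `invMulOmega_psi` (`ψ⁻¹ω = χ⁻¹↑·((ω^k)⁻¹ω)↑`), **`conductor_invMulOmega_psi`** (`= m·p`),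
  **`primVal_invMulOmega_psi_ne_one`** ((1b)/(3b)), **`psi_traceIdentity`**
  (`ψ(ℓ) + ψ⁻¹(ℓ)ω(ℓ) = χ(ℓ)·(ω(ℓ)^k + ω(ℓ)^{p−k})` for `p ∤ ℓ` — both sides vanish when `(ℓ, m) ≠ 1`),
  `psi_odd_of` (parity: `ψ(−1) = χ(−1)·(−1)^k`), `exists_exponent_odd` (one of two exponents of opposite parity makes `ψ` odd).

THEOREMS ONLY; no definitions, no named facts, no instances. beyond-print theorem: NO.
References: [KrizLi2019] Thm. 1.20, §1.5, §2 (pp. 7, 11–12); [Washington1997] Ch. 3 (conductors), §5.1 (Teichmüller character).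
-/

noncomputable section

-- summit-side namespace `Summit.BirchSwinnertonDyer.BirchSwinnertonDyer.…` (single-conjunct summit, D-0017 layout)
set_option linter.dupNamespace false

open scoped Classical
open DirichletCharacter Literature.NumberTheory.EllipticCurves.KrizLi2019
open Summit.BirchSwinnertonDyer.Rank1Residual.X12.O11.RouteU

namespace Summit.BirchSwinnertonDyer.BirchSwinnertonDyer.Theorems.PrintCFram.KrizLiBinders

variable {p : ℕ} [hp : Fact p.Prime]

/-! ## §1 The Teichmüller character: exact order `p − 1`, value `−1` at `−1` -/

/-- In `ℚ_p`: `‖x − a‖ < 1` with `a ∈ ℤ` forces `‖x‖ ≤ 1`. [folklore] -/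
private theorem norm_le_one_of_norm_sub_intCast_lt_one' {x : ℚ_[p]} {a : ℤ}
    (h : ‖x - (a : ℚ_[p])‖ < 1) : ‖x‖ ≤ 1 := by
  have : x = (x - a) + a := by ring
  rw [this]
  exact (Padic.nonarchimedean _ _).trans (max_le h.le (Padic.norm_int_le_one a))

/-- In `ℚ_p`: `‖x − y‖ < 1` with `x, y` integral ⇒ `‖xʲ − yʲ‖ < 1` (`x − y ∣ xʲ − yʲ` in `ℤ_p`). [folklore] -/
private theorem norm_pow_sub_pow_lt_one' {x y : ℚ_[p]} (hx : ‖x‖ ≤ 1) (hy : ‖y‖ ≤ 1)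
    (h : ‖x - y‖ < 1) (j : ℕ) : ‖x ^ j - y ^ j‖ < 1 := by
  set X : ℤ_[p] := ⟨x, hx⟩
  set Y : ℤ_[p] := ⟨y, hy⟩
  obtain ⟨q, hq⟩ := sub_dvd_pow_sub_pow X Y j
  have hXY : ‖X - Y‖ < 1 := by rw [PadicInt.norm_def, PadicInt.coe_sub]; exact h
  have e : x ^ j - y ^ j = ((X ^ j - Y ^ j : ℤ_[p]) : ℚ_[p]) := by push_cast; rfl
  rw [e, hq, PadicInt.coe_mul, norm_mul]
  calc ‖((X - Y : ℤ_[p]) : ℚ_[p])‖ * ‖(q : ℚ_[p])‖ ≤ ‖((X - Y : ℤ_[p]) : ℚ_[p])‖ * 1 :=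
        mul_le_mul_of_nonneg_left (PadicInt.norm_le_one q) (norm_nonneg _)
    _ < 1 := by rw [mul_one, ← PadicInt.norm_def]; exact hXY

/-- **`ω^j ≠ 1` for `0 < j < p − 1`**: the Teichmüller character has exact order `p − 1`. Take a generator `g` of the cyclic
group `(ℤ/p)ˣ` (order `p − 1`); `ω(g) ≡ g (mod p)` gives `ω(g)^j ≡ g^j`, so `ω^j = 1` would force `g^j ≡ 1 (mod p)`, i.e.
`p − 1 ∣ j`. [cite: Washington1997, §5.1 (ω generates the character group of (ℤ/p)ˣ)] -/
theorem teichmuller_pow_ne_one {ω : DirichletCharacter ℚ_[p] p} (hω : IsTeichmullerCharacter ω) {j : ℕ}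
    (hj0 : 0 < j) (hj : j < p - 1) : ω ^ j ≠ 1 := by
  intro h1
  have hpp : p.Prime := hp.out
  obtain ⟨g, hg⟩ := IsCyclic.exists_generator (α := (ZMod p)ˣ)
  have hord : orderOf g = p - 1 := by
    rw [orderOf_eq_card_of_forall_mem_zpowers hg, Nat.card_eq_fintype_card, ZMod.card_units]
  -- the least residue `n` of `g`
  set n : ℕ := (g : ZMod p).val with hn
  have hng : (n : ZMod p) = (g : ZMod p) := by rw [hn, ZMod.natCast_zmod_val]
  have hpn : ¬ ((p : ℤ) ∣ (n : ℤ)) := by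
    intro h
    have h' : (n : ZMod p) = 0 := by
      rw [← Int.cast_natCast, (ZMod.intCast_zmod_eq_zero_iff_dvd _ p).mpr h]
    rw [hng] at h'
    exact g.ne_zero h'
  -- `ω(g)^j = 1`
  have hωj : ω (n : ZMod p) ^ j = 1 := by
    rw [← MulChar.pow_apply' ω hj0.ne', h1, hng, MulChar.one_apply (Units.isUnit g)]
  -- `‖ω(g) − n‖ < 1` ⟹ `‖1 − n^j‖ < 1` ⟹ `p ∣ 1 − n^j`
  have hT : ‖ω (n : ZMod p) - (n : ℚ_[p])‖ < 1 := by
    have := hω (n : ℤ) hpn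
    push_cast at this
    exact this
  have hω1 : ‖ω (n : ZMod p)‖ ≤ 1 := norm_le_one_of_norm_sub_intCast_lt_one' (a := n) (by push_cast; exact hT)
  have hn1 : ‖(n : ℚ_[p])‖ ≤ 1 := by exact_mod_cast Padic.norm_int_le_one (n : ℤ)
  have hpow := norm_pow_sub_pow_lt_one' hω1 hn1 hT j
  rw [hωj] at hpow
  have hdvd : (p : ℤ) ∣ 1 - (n : ℤ) ^ j := by
    have : ‖(((1 - (n : ℤ) ^ j : ℤ)) : ℚ_[p])‖ < 1 := by push_cast; exact hpow
    exact (Padic.norm_intCast_lt_one_iff (p := p)).mp this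
  -- so `g^j = 1` in `(ℤ/p)ˣ`, and `p − 1 ∣ j`
  have hgj : (g : ZMod p) ^ j = 1 := by
    have h0 : (((1 - (n : ℤ) ^ j : ℤ)) : ZMod p) = 0 := (ZMod.intCast_zmod_eq_zero_iff_dvd _ p).mpr hdvd
    push_cast at h0
    rw [hng] at h0
    exact (sub_eq_zero.mp h0).symm
  have hgj' : g ^ j = 1 := Units.ext (by rw [Units.val_pow_eq_pow_val, hgj, Units.val_one])
  have hdiv : p - 1 ∣ j := hord ▸ orderOf_dvd_of_pow_eq_one hgj'
  exact absurd (Nat.le_of_dvd hj0 hdiv) (not_le.mpr hj)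

/-- **`ω(−1) = −1`** for a Teichmüller character modulo an odd prime: `ω(−1)² = ω(1) = 1` and `ω(−1) ≡ −1 ≢ 1 (mod p)`.
[cite: Washington1997, §5.1 (ω(a) ≡ a mod p)] -/
theorem teichmuller_apply_neg_one (hp2 : p ≠ 2) {ω : DirichletCharacter ℚ_[p] p} (hω : IsTeichmullerCharacter ω) :
    ω (-1) = -1 := by
  have hsq : ω (-1) ^ 2 = 1 := by rw [← map_pow, neg_one_sq, map_one]
  rcases sq_eq_one_iff.mp hsq with h | h
  · exfalso
    have hp1 : ¬ ((p : ℤ) ∣ (-1 : ℤ)) := by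
      intro hd
      have : (p : ℤ) ∣ 1 := (dvd_neg).mp hd
      have hp1' : p ∣ 1 := by exact_mod_cast this
      exact hp.out.one_lt.ne' (Nat.dvd_one.mp hp1')
    have hT := hω (-1) hp1
    push_cast at hT
    rw [h, sub_neg_eq_add, show (1 : ℚ_[p]) + 1 = ((2 : ℕ) : ℚ_[p]) by norm_num] at hT
    have h2 : ‖((2 : ℕ) : ℚ_[p])‖ = 1 := by
      rw [Padic.norm_natCast_eq_one_iff]
      exact (Nat.coprime_primes hp.out Nat.prime_two).mpr hp2
    rw [h2] at hT
    exact lt_irrefl _ hT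
  · exact h

/-- For `2 ≤ k ≤ p − 2`: **`ω^k ≠ 1` and `(ω^k)⁻¹·ω ≠ 1`** (i.e. `ω^k ≠ ω`) — the two non-vanishings that make `ψ = χ·ω^k`
and `ψ⁻¹ω = χ·ω^{1−k}` primitive of conductor `p·m`. [cite: Washington1997, §5.1] -/
theorem teichmuller_pow_ne_one_and {ω : DirichletCharacter ℚ_[p] p} (hω : IsTeichmullerCharacter ω) {k : ℕ}
    (hk2 : 2 ≤ k) (hkp : k ≤ p - 2) : ω ^ k ≠ 1 ∧ (ω ^ k)⁻¹ * ω ≠ 1 := by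
  refine ⟨teichmuller_pow_ne_one hω (by omega) (by omega), fun h => ?_⟩
  -- `(ω^k)⁻¹ ω = 1` ⟹ `ω = ω^k` ⟹ `ω^{k−1} = 1`
  have h1 : ω ^ k = ω := by
    have := congrArg (fun θ => ω ^ k * θ) h
    have h' : ω = ω ^ k := by simpa [← mul_assoc] using this
    exact h'.symm
  have h2 : ω ^ (k - 1) = 1 := by
    have e : ω ^ k = ω ^ (k - 1) * ω := by rw [← pow_succ, Nat.sub_add_cancel (by omega)]
    rw [e] at h1
    exact mul_eq_right.mp h1
  exact teichmuller_pow_ne_one hω (by omega) (by omega) h2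

/-! ## §2 The character `ψ = χ↑ · (ω^k)↑` at level `p·m` -/

section Psi

variable {m : ℕ} [hm : NeZero m] (ω : DirichletCharacter ℚ_[p] p) (χ : DirichletCharacter ℚ_[p] m) (k : ℕ)

omit hm in
/-- **Values at the units: `ψ(a) = χ(a)·ω(a)^k`** for `a` coprime to `p·m` (`k ≠ 0`).
[cite: KrizLi2019, §2 (p. 11, conventions on characters)] -/
theorem psi_apply_natCast_of_coprime (hk0 : k ≠ 0) {a : ℕ} (ha : a.Coprime (p * m)) :
    (changeLevel (dvd_mul_left m p) χ * changeLevel (dvd_mul_right p m) (ω ^ k) :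
      DirichletCharacter ℚ_[p] (p * m)) (a : ZMod (p * m)) = χ (a : ZMod m) * ω (a : ZMod p) ^ k := by
  have hu : IsCoprime (a : ℤ) ((p * m : ℕ) : ℤ) := Nat.isCoprime_iff_coprime.mpr ha
  have e : ((a : ℤ) : ZMod (p * m)) = (a : ZMod (p * m)) := by push_cast; rfl
  rw [← e, MulChar.mul_apply, changeLevel_eq_cast_of_dvd' _ _ hu, changeLevel_eq_cast_of_dvd' _ _ hu,
    MulChar.pow_apply' _ hk0, Int.cast_natCast, Int.cast_natCast]

omit hm in
/-- **Values off the units: `ψ(a) = 0`** for `a` not coprime to `p·m`. [cite: KrizLi2019, §2 (p. 11, «ψ(a) = 0 if (a, f(ψ)) ≠ 1»)] -/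
theorem psi_apply_natCast_of_not_coprime (ψ : DirichletCharacter ℚ_[p] (p * m)) {a : ℕ} (ha : ¬ a.Coprime (p * m)) :
    ψ (a : ZMod (p * m)) = 0 :=
  MulChar.map_nonunit _ (by rwa [ZMod.isUnit_iff_coprime])

omit hm in
/-- **(1a)/(3a): `ψ(a) ≠ 1` whenever `a` is not coprime to `p·m`** — in particular at `a = p` and at every `a = ℓ ∣ m`.
[cite: KrizLi2019, Thm. 1.20 (1), (3) (p. 7)] -/
theorem psi_apply_natCast_ne_one (ψ : DirichletCharacter ℚ_[p] (p * m)) {a : ℕ} (ha : ¬ a.Coprime (p * m)) :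
    ψ (a : ZMod (p * m)) ≠ 1 :=
  apply_natCast_ne_one_of_not_coprime ψ a ha

/-- **`ψ` is primitive of conductor `p·m`** when `χ` is primitive mod `m`, `(m, p) = 1` and `ω^k ≠ 1`
(conductors `m` and `p` are coprime, so they multiply). [cite: KrizLi2019, Thm. 1.20 (p. 7, «ψ primitive of conductor f»)]
[cite: Washington1997, Ch. 3 (conductor of a product of characters of coprime conductor)] -/
theorem psi_isPrimitive (hmp : m.Coprime p) (hχ : χ.IsPrimitive) (hωk : ω ^ k ≠ 1) :
    (changeLevel (dvd_mul_left m p) χ * changeLevel (dvd_mul_right p m) (ω ^ k) :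
      DirichletCharacter ℚ_[p] (p * m)).IsPrimitive := by
  haveI : NeZero (p * m) := ⟨Nat.mul_ne_zero hp.out.ne_zero hm.out⟩
  have hcq : χ.conductor = m := hχ
  have hcp : (ω ^ k).conductor = p := conductor_eq_of_prime_of_ne_one (ω ^ k) hωk
  rw [isPrimitive_def, conductor_changeLevel_mul_changeLevel _ _ χ (ω ^ k) (by rw [hcq, hcp]; exact hmp),
    hcq, hcp, mul_comm]

omit hm in
/-- **`ψ⁻¹ω = χ⁻¹↑ · ((ω^k)⁻¹ω)↑`** at level `p·m·p` (the tree's `invMulOmega ψ ω`).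
[cite: KrizLi2019, Thm. 1.20 (p. 7, hypotheses (1) and (3))] -/
theorem invMulOmega_psi :
    invMulOmega (changeLevel (dvd_mul_left m p) χ * changeLevel (dvd_mul_right p m) (ω ^ k)) ω =
      changeLevel ((dvd_mul_left m p).trans (dvd_mul_right (p * m) p)) χ⁻¹ *
        changeLevel (dvd_mul_left p (p * m)) ((ω ^ k)⁻¹ * ω) := by
  unfold invMulOmega
  rw [mul_inv, map_mul, ← map_inv, ← map_inv, ← changeLevel_trans, ← changeLevel_trans, map_mul]
  exact mul_assoc _ _ _

/-- **`f(ψ⁻¹ω) = m·p`** when `χ` is primitive mod `m`, `(m, p) = 1` and `(ω^k)⁻¹ω ≠ 1`.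
[cite: KrizLi2019, Thm. 1.20 (p. 7)] [cite: Washington1997, Ch. 3] -/
theorem conductor_invMulOmega_psi (hmp : m.Coprime p) (hχ : χ.IsPrimitive) (hωk1 : (ω ^ k)⁻¹ * ω ≠ 1) :
    (invMulOmega (changeLevel (dvd_mul_left m p) χ * changeLevel (dvd_mul_right p m) (ω ^ k)) ω).conductor
      = m * p := by
  haveI : NeZero (p * m * p) := ⟨Nat.mul_ne_zero (Nat.mul_ne_zero hp.out.ne_zero hm.out) hp.out.ne_zero⟩
  rw [invMulOmega_psi]
  have hcp := conductor_eq_of_prime_of_ne_one ((ω ^ k)⁻¹ * ω) hωk1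
  have hcq : χ⁻¹.conductor = m := by rw [conductor_inv]; exact hχ
  rw [conductor_changeLevel_mul_changeLevel _ _ χ⁻¹ ((ω ^ k)⁻¹ * ω) (by rw [hcq, hcp]; exact hmp), hcq, hcp]

/-- **(1b)/(3b): `(ψ⁻¹ω)(a) ≠ 1` (value of the PRIMITIVE character) whenever `a` is not coprime to `p·m`** — the value is
`0`, the conductor being `m·p`. [cite: KrizLi2019, Thm. 1.20 (1), (3) (p. 7)] -/
theorem primVal_invMulOmega_psi_ne_one (hmp : m.Coprime p) (hχ : χ.IsPrimitive) (hωk1 : (ω ^ k)⁻¹ * ω ≠ 1)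
    {a : ℕ} (ha : ¬ a.Coprime (p * m)) :
    primVal (invMulOmega (changeLevel (dvd_mul_left m p) χ * changeLevel (dvd_mul_right p m) (ω ^ k)) ω) a ≠ 1 := by
  apply primVal_ne_one_of_not_coprime
  rw [conductor_invMulOmega_psi ω χ k hmp hχ hωk1, mul_comm]
  exact ha

omit hm in
/-- **The `hss` value identity: `ψ(ℓ) + ψ⁻¹(ℓ)ω(ℓ) = χ(ℓ)·(ω(ℓ)^k + ω(ℓ)^{p−k})` for every `ℓ` with `p ∤ ℓ`**
(`χ` quadratic, `1 ≤ k ≤ p − 1`; when `(ℓ, m) ≠ 1` both sides vanish). With `k = (p+1)/4` the exponent pair is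
`((p+1)/4, (3p−1)/4)` and with `k = (3p−1)/4` it is the same pair swapped — the trace form of
`ρ̄^{ss} ≅ χ ⊗ (ω^{(p+1)/4} ⊕ ω^{(3p−1)/4})`. [cite: KrizLi2019, Thm. 1.20 and §2 (trace form a_ℓ ≡ ψ(ℓ) + ψ⁻¹ω(ℓ))] -/
theorem psi_traceIdentity (hχq : χ.IsQuadratic) (hk0 : k ≠ 0) (hkp : k ≤ p - 1) (ℓ : ℕ) (hℓ : ¬ p ∣ ℓ) :
    (changeLevel (dvd_mul_left m p) χ * changeLevel (dvd_mul_right p m) (ω ^ k) :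
        DirichletCharacter ℚ_[p] (p * m)) (ℓ : ZMod (p * m)) +
      (changeLevel (dvd_mul_left m p) χ * changeLevel (dvd_mul_right p m) (ω ^ k) :
        DirichletCharacter ℚ_[p] (p * m))⁻¹ (ℓ : ZMod (p * m)) * ω (ℓ : ZMod p) =
      χ (ℓ : ZMod m) * (ω (ℓ : ZMod p) ^ k + ω (ℓ : ZMod p) ^ (p - k)) := by
  set ψ : DirichletCharacter ℚ_[p] (p * m) :=
    changeLevel (dvd_mul_left m p) χ * changeLevel (dvd_mul_right p m) (ω ^ k) with hψdef
  by_cases hℓm : ℓ.Coprime m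
  · have hcop : ℓ.Coprime (p * m) :=
      Nat.Coprime.mul_right ((Nat.Prime.coprime_iff_not_dvd hp.out).mpr hℓ).symm hℓm
    have hψℓ : ψ (ℓ : ZMod (p * m)) = χ (ℓ : ZMod m) * ω (ℓ : ZMod p) ^ k := by
      rw [hψdef, psi_apply_natCast_of_coprime ω χ k hk0 hcop]
    -- `χ(ℓ)² = 1`, `ω(ℓ)^{p−1} = 1`
    have hχne : χ (ℓ : ZMod m) ≠ 0 :=
      (((ZMod.isUnit_iff_coprime ℓ m).mpr hℓm).map χ).ne_zero
    have hωne : ω (ℓ : ZMod p) ≠ 0 :=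
      (((ZMod.isUnit_iff_coprime ℓ p).mpr ((Nat.Prime.coprime_iff_not_dvd hp.out).mpr hℓ).symm).map ω).ne_zero
    have hχ2 : χ (ℓ : ZMod m) ^ 2 = 1 := by
      rcases hχq (ℓ : ZMod m) with h | h | h
      · exact absurd h hχne
      · rw [h]; norm_num
      · rw [h]; norm_num
    have hωp : ω (ℓ : ZMod p) ^ (p - 1) = 1 := by
      have := apply_pow_sub_one_eq_one ω (ℓ : ℤ) (by exact_mod_cast hℓ)
      rwa [Int.cast_natCast] at this
    have hinv : ψ⁻¹ (ℓ : ZMod (p * m)) * ω (ℓ : ZMod p) = χ (ℓ : ZMod m) * ω (ℓ : ZMod p) ^ (p - k) := by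
      rw [MulChar.inv_apply_eq_inv', hψℓ]
      have hne : χ (ℓ : ZMod m) * ω (ℓ : ZMod p) ^ k ≠ 0 := mul_ne_zero hχne (pow_ne_zero _ hωne)
      apply (inv_mul_eq_iff_eq_mul₀ hne).mpr
      -- `ω(ℓ) = (χ ω^k)·(χ ω^{p−k})` using `χ² = 1`, `ω^{p−1} = 1`
      have e : p - k + k = (p - 1) + 1 := by omega
      calc ω (ℓ : ZMod p) = ω (ℓ : ZMod p) ^ ((p - 1) + 1) := by rw [pow_succ, hωp, one_mul]
        _ = χ (ℓ : ZMod m) ^ 2 * ω (ℓ : ZMod p) ^ (p - k + k) := by rw [hχ2, one_mul, e]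
        _ = χ (ℓ : ZMod m) * ω (ℓ : ZMod p) ^ k * (χ (ℓ : ZMod m) * ω (ℓ : ZMod p) ^ (p - k)) := by ring
    rw [hψℓ, hinv]
    ring
  · -- `(ℓ, m) ≠ 1`: both sides vanish
    have hχ0 : χ (ℓ : ZMod m) = 0 := MulChar.map_nonunit _ (by rwa [ZMod.isUnit_iff_coprime])
    have hncop : ¬ ℓ.Coprime (p * m) := fun h => hℓm (Nat.Coprime.coprime_mul_left_right h)
    have hψ0 : ψ (ℓ : ZMod (p * m)) = 0 := psi_apply_natCast_of_not_coprime ψ hncop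
    have hψ0' : ψ⁻¹ (ℓ : ZMod (p * m)) = 0 := psi_apply_natCast_of_not_coprime ψ⁻¹ hncop
    rw [hψ0, hψ0', hχ0]
    ring

omit hm in
/-- **Parity: `ψ(−1) = χ(−1)·ω(−1)^k = χ(−1)·(−1)^k`**, so `ψ` is ODD as soon as `χ(−1)·(−1)^k = −1` (`p` odd).
[cite: KrizLi2019, §1.5 (p. 7, ψ₀ = ψε_K for ψ odd)] -/
theorem psi_odd_of (hp2 : p ≠ 2) (hω : IsTeichmullerCharacter ω) (hk0 : k ≠ 0) (h : χ (-1) * (-1) ^ k = -1) :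
    (changeLevel (dvd_mul_left m p) χ * changeLevel (dvd_mul_right p m) (ω ^ k) :
      DirichletCharacter ℚ_[p] (p * m)).Odd := by
  have hu : IsCoprime (-1 : ℤ) ((p * m : ℕ) : ℤ) := (isCoprime_one_left (x := ((p * m : ℕ) : ℤ))).neg_left
  have e : ((-1 : ℤ) : ZMod (p * m)) = -1 := by push_cast; rfl
  rw [DirichletCharacter.Odd, ← e, MulChar.mul_apply, changeLevel_eq_cast_of_dvd' _ _ hu,
    changeLevel_eq_cast_of_dvd' _ _ hu, MulChar.pow_apply' _ hk0]
  push_cast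
  rw [teichmuller_apply_neg_one hp2 hω, h]

end Psi

/-- **Choosing the exponent for oddness.** If `χ(−1) = ±1` and `k₁ + k₂` is odd, then for one `k ∈ {k₁, k₂}`:
`χ(−1)·(−1)^k = −1`. (On the class: `k₁ = (p+1)/4`, `k₂ = (3p−1)/4`, `k₂ − k₁ = (p−1)/2` odd for `p ≡ 3 (mod 4)`; Kriz–Li's
hypotheses are symmetric under `ψ ↔ ψ⁻¹ω`, FMS §7.1, so the odd member of the pair may be called `ψ`.)
[cite: KrizLi2019, §7.1 (p. 43, «we may assume without loss of generality that ψ ≠ ω (otherwise, interchange ψ and ψ⁻¹ω)»)] -/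
theorem exists_exponent_odd {R : Type*} [CommRing R] {c : R} (hc : c = 1 ∨ c = -1) {k₁ k₂ : ℕ} (hodd : Odd (k₁ + k₂)) :
    ∃ k : ℕ, (k = k₁ ∨ k = k₂) ∧ c * (-1) ^ k = -1 := by
  rcases Nat.even_or_odd k₁ with h1 | h1
  · have h2 : Odd k₂ := by
      rcases Nat.even_or_odd k₂ with h2 | h2
      · exact absurd hodd (Nat.not_odd_iff_even.mpr (h1.add h2))
      · exact h2
    rcases hc with rfl | rfl
    · exact ⟨k₂, Or.inr rfl, by rw [h2.neg_one_pow]; ring⟩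
    · exact ⟨k₁, Or.inl rfl, by rw [h1.neg_one_pow]; ring⟩
  · have h2 : Even k₂ := by
      rcases Nat.even_or_odd k₂ with h2 | h2
      · exact h2
      · exact absurd hodd (Nat.not_odd_iff_even.mpr (h1.add_odd h2))
    rcases hc with rfl | rfl
    · exact ⟨k₁, Or.inl rfl, by rw [h1.neg_one_pow]; ring⟩
    · exact ⟨k₂, Or.inr rfl, by rw [h2.neg_one_pow]; ring⟩

end Summit.BirchSwinnertonDyer.BirchSwinnertonDyer.Theorems.PrintCFram.KrizLiBinders

end
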